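import Literature.MathematicalPhysics.QuantumManyBody.ThermalExpectation

/-!
# Route `BECClassicalWindow` — support item `ThermalGroundStateLimit` (stmt-AtomisticToContinuum-9073):
# Gibbs' inequality, free energy bounded below, low-temperature concentration of near-Gibbs ensembles

Helper file for stmt-AtomisticToContinuum-9073 (`ThermalGroundStateLimit`): the thermodynamic
bookkeeping on finite ensembles (`FiniteEnsemble` layer of `ThermalExpectation.lean`), independent
of the spectral input.

* `neg_mul_log_sum_exp_le` — **Gibbs' inequality** for a finite probability vector `p` and reals
  `aᵢ`: `∑ pᵢ aᵢ - T ∑(-pᵢ ln pᵢ) ≥ -T ln ∑_{pᵢ>0} e^{-aᵢ/T}` (`ln x ≤ x - 1`);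
* `freeEnergy_ge` — given a partition bound `∑ᵢ e^{-⟨Ψᵢ,HΨᵢ⟩} ≤ Z` on orthonormal sub-families
  of finite energy, the free energy `Tr(HΓ) - T S(Γ)` of finite orthogonal ensembles of Dirichlet
  trial states is `≥ -ln Z` for `0 < T ≤ 1` — the hypothesis of
  `FiniteEnsemble.exists_isNearGibbs` (near-Gibbs ensembles exist at every slack);
* the `β → ∞` estimate proper (`sum_mul_sub_groundStateEnergy_le`, `mul_sum_weights_high_le`): if `Γ = (pᵢ, Ψᵢ)` is an `ε`-near-Gibbs finite orthogonal ensemble of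
Dirichlet trial states at temperature `T ≤ 1/2`, `E₀ = inf ⟨Ψ,HΨ⟩ < ∞`, `Ψ⋆` is a trial state
with `⟨Ψ⋆, HΨ⋆⟩ ≤ E₀ + η`, and `Z` is the partition bound of `exists_sum_exp_neg_energy_le`, then
the mean excitation energy of `Γ` is small,

  `∑ᵢ pᵢ (⟨Ψᵢ,HΨᵢ⟩ - E₀) ≤ 2(η + ε) + 2T (E₀ + ln Z)`,

(compare `Γ` with the pure state `Ψ⋆`, and bound the entropy it can gain by Gibbs' inequality at
temperature `2T`: `∑ pᵢeᵢ - 2T S(p) ≥ -2T ln ∑ e^{-eᵢ/2T} ≥ -2T ln (e^{E₀} Z)`), whence by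
Markov the total weight of the states of energy `> E₀ + δ` is `≤ (2(η+ε) + 2T(E₀ + ln Z))/δ`
(`sum_weights_high_le`). This is the ensemble-level substitute for "`Γ_T → ` ground space as
`T → 0`".
-/

noncomputable section

namespace Summit.AtomisticToContinuum.BoseEinsteinCondensation.Theorems

open MeasureTheory Filter Set Complex
open scoped ENNReal NNReal Topology ComplexConjugate BigOperators
open Literature.MathematicalPhysics.QuantumManyBody.BoseGas
open Literature.MathematicalPhysics.QuantumManyBody
open Literature.MathematicalPhysics.QuantumManyBody.FiniteEnsemble

namespace ThermalGroundStateLimit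

variable {N : ℕ} {L : ℝ}

/-! ### Gibbs' inequality for finite probability vectors -/

/-- **Gibbs' inequality** (non-negativity of the relative entropy, `ln x ≤ x - 1`): for a finite
probability vector `p` (`pᵢ ≥ 0`, `∑ pᵢ = 1`), reals `aᵢ` and `T > 0`,
`∑_{pᵢ>0} pᵢ aᵢ - T ∑ᵢ (-pᵢ ln pᵢ) ≥ -T ln ∑_{pᵢ>0} e^{-aᵢ/T}` — the free energy of any state is
at least `-T ln Z`. [folklore] -/
theorem neg_mul_log_sum_exp_le {ι : Type*} [Fintype ι] [DecidableEq ι] {p : ι → ℝ}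
    (hp0 : ∀ i, 0 ≤ p i) (hp1 : ∑ i, p i = 1) (a : ι → ℝ) {T : ℝ} (hT : 0 < T) :
    -(T * Real.log (∑ i ∈ Finset.univ.filter (fun i => 0 < p i), Real.exp (-(a i / T)))) ≤
      ∑ i ∈ Finset.univ.filter (fun i => 0 < p i), p i * a i - T * ∑ i, Real.negMulLog (p i) := by
  set s := Finset.univ.filter (fun i => 0 < p i) with hs
  have hmem : ∀ i, i ∈ s ↔ 0 < p i := fun i => by simp [hs]
  -- the support is non-empty and carries all the mass and all the entropy
  have hsum_s : ∑ i ∈ s, p i = 1 := by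
    rw [← hp1, ← Finset.sum_filter_add_sum_filter_not Finset.univ (fun i => 0 < p i)]
    rw [Finset.sum_eq_zero (s := Finset.univ.filter fun i => ¬0 < p i) (fun i hi => ?_), add_zero]
    rw [Finset.mem_filter] at hi
    exact le_antisymm (not_lt.1 hi.2) (hp0 i)
  have hent : ∑ i, Real.negMulLog (p i) = ∑ i ∈ s, Real.negMulLog (p i) := by
    rw [← Finset.sum_filter_add_sum_filter_not Finset.univ (fun i => 0 < p i)]
    rw [Finset.sum_eq_zero (s := Finset.univ.filter fun i => ¬0 < p i) (fun i hi => ?_), add_zero]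
    rw [Finset.mem_filter] at hi
    rw [le_antisymm (not_lt.1 hi.2) (hp0 i), Real.negMulLog_zero]
  set Zf : ℝ := ∑ i ∈ s, Real.exp (-(a i / T)) with hZf
  have hsne : s.Nonempty := by
    by_contra h
    rw [Finset.not_nonempty_iff_eq_empty] at h
    rw [h, Finset.sum_empty] at hsum_s
    exact zero_ne_one hsum_s
  have hZpos : 0 < Zf := Finset.sum_pos (fun i _ => Real.exp_pos _) hsne
  -- `q = e^{-a/T}/Z`, and `p ln(q/p) ≤ q - p` termwise
  set q : ι → ℝ := fun i => Real.exp (-(a i / T)) / Zf with hq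
  have hq1 : ∑ i ∈ s, q i = 1 := by
    rw [hq]; simp only
    rw [← Finset.sum_div, div_self hZpos.ne']
  have hqpos : ∀ i, 0 < q i := fun i => div_pos (Real.exp_pos _) hZpos
  have hterm : ∀ i ∈ s, p i * Real.log (q i) + Real.negMulLog (p i) ≤ q i - p i := by
    intro i hi
    have hpi : 0 < p i := (hmem i).1 hi
    have h1 : Real.log (q i / p i) ≤ q i / p i - 1 := Real.log_le_sub_one_of_pos (div_pos (hqpos i) hpi)
    rw [Real.log_div (hqpos i).ne' hpi.ne'] at h1
    have h2 := mul_le_mul_of_nonneg_left h1 hpi.le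
    rw [mul_sub, mul_sub, mul_div_cancel₀ _ hpi.ne', mul_one] at h2
    rw [Real.negMulLog]
    linarith
  have hsum := Finset.sum_le_sum hterm
  rw [Finset.sum_add_distrib, Finset.sum_sub_distrib, hq1, hsum_s, sub_self, ← hent] at hsum
  -- `∑ p ln q = -(1/T) ∑ p a - ln Z`
  have hlogq : ∀ i, Real.log (q i) = -(a i / T) - Real.log Zf := fun i => by
    rw [hq]; simp only
    rw [Real.log_div (Real.exp_pos _).ne' hZpos.ne', Real.log_exp]
  simp only [hlogq, mul_sub, Finset.sum_sub_distrib, ← Finset.sum_mul, hsum_s, one_mul] at hsum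
  have hpa : ∑ i ∈ s, p i * -(a i / T) = -(1 / T) * ∑ i ∈ s, p i * a i := by
    rw [Finset.mul_sum]
    refine Finset.sum_congr rfl fun i _ => ?_
    field_simp
  rw [hpa] at hsum
  -- multiply by `T > 0`
  have h3 := mul_le_mul_of_nonneg_left hsum hT.le
  rw [mul_zero] at h3
  have h4 : T * (-(1 / T) * ∑ i ∈ s, p i * a i - Real.log Zf + ∑ i, Real.negMulLog (p i)) =
      -(∑ i ∈ s, p i * a i) - T * Real.log Zf + T * ∑ i, Real.negMulLog (p i) := by
    field_simp
  rw [h4] at h3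
  linarith

/-! ### The free energy of finite orthogonal ensembles is bounded below -/

/-- The energy average of an ensemble, as a real number, is the weighted sum of the real energies
over the states of positive weight (states of weight zero may have infinite energy).
[folklore] -/
theorem toReal_average_energy {v : ℝ → ℝ≥0∞} {m : ℕ} {p : Fin m → ℝ} {Ψ : Fin m → TrialState N L}
    (hp0 : ∀ i, 0 ≤ p i) (hA : FiniteEnsemble.average (energy v) p Ψ ≠ ⊤) :
    (FiniteEnsemble.average (energy v) p Ψ).toReal =
      ∑ i ∈ Finset.univ.filter (fun i => 0 < p i), p i * (energy v (Ψ i)).toReal := by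
  classical
  unfold FiniteEnsemble.average at hA ⊢
  have hterm : ∀ i ∈ Finset.univ, ENNReal.ofReal (p i) * energy v (Ψ i) ≠ ⊤ := fun i _ =>
    (ENNReal.lt_top_of_sum_ne_top hA (Finset.mem_univ i)).ne
  rw [ENNReal.toReal_sum hterm, ← Finset.sum_filter_add_sum_filter_not Finset.univ (fun i => 0 < p i)]
  rw [Finset.sum_eq_zero (s := Finset.univ.filter fun i => ¬0 < p i) (fun i hi => ?_), add_zero]
  · refine Finset.sum_congr rfl fun i _ => ?_
    rw [ENNReal.toReal_mul, ENNReal.toReal_ofReal (hp0 i)]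
  · rw [Finset.mem_filter] at hi
    rw [le_antisymm (not_lt.1 hi.2) (hp0 i), ENNReal.ofReal_zero, zero_mul, ENNReal.toReal_zero]

/-- In an ensemble of finite energy average, the states of positive weight have finite energy.
[folklore] -/
theorem energy_ne_top_of_average_ne_top {v : ℝ → ℝ≥0∞} {m : ℕ} {p : Fin m → ℝ}
    {Ψ : Fin m → TrialState N L} (hA : FiniteEnsemble.average (energy v) p Ψ ≠ ⊤) {i : Fin m}
    (hi : 0 < p i) : energy v (Ψ i) ≠ ⊤ := by
  unfold FiniteEnsemble.average at hA
  have h := (ENNReal.lt_top_of_sum_ne_top hA (Finset.mem_univ i)).ne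
  intro htop
  rw [htop, ENNReal.mul_top (ENNReal.ofReal_pos.2 hi).ne'] at h
  exact h rfl

/-- **The free energy is bounded below, uniformly in `0 < T ≤ 1`.** With `Z` the partition bound
of `exists_sum_exp_neg_energy_le`: every finite orthogonal ensemble of Dirichlet trial states
with finite energy average has `Tr(HΓ) - T S(Γ) ≥ -T ln Z ≥ -ln Z` (Gibbs' inequality and
`e^{-E/T} ≤ e^{-E}` for `E ≥ 0`, `T ≤ 1`) — the hypothesis of
`FiniteEnsemble.exists_isNearGibbs`. [folklore] -/
theorem freeEnergy_ge {v : ℝ → ℝ≥0∞} {Z : ℝ} (hZ1 : 1 ≤ Z)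
    (hZ : ∀ (m : ℕ) (Ψ : Fin m → TrialState N L) (s : Finset (Fin m)),
      (∀ i ∈ s, ∀ j ∈ s, i ≠ j → ∫ X, conj ((Ψ i).ψ X) * (Ψ j).ψ X = 0) →
      (∀ i ∈ s, energy v (Ψ i) ≠ ⊤) →
        ∑ i ∈ s, Real.exp (-(energy v (Ψ i)).toReal) ≤ Z)
    {T : ℝ} (hT : 0 < T) (hT1 : T ≤ 1) (m : ℕ) (p : Fin m → ℝ) (Ψ : Fin m → TrialState N L)
    (hE : FiniteEnsemble.IsEnsemble TrialState.IsOrthogonal p Ψ)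
    (hA : FiniteEnsemble.average (energy v) p Ψ ≠ ⊤) :
    -Real.log Z ≤ (FiniteEnsemble.average (energy v) p Ψ).toReal - T * FiniteEnsemble.entropy p := by
  classical
  set s := Finset.univ.filter (fun i => 0 < p i) with hs
  have hmem : ∀ i, i ∈ s ↔ 0 < p i := fun i => by simp [hs]
  rw [toReal_average_energy hE.nonneg hA]
  unfold FiniteEnsemble.entropy
  have hG := neg_mul_log_sum_exp_le hE.nonneg hE.sum_eq_one (fun i => (energy v (Ψ i)).toReal) hT
  refine le_trans ?_ hG
  -- `-ln Z ≤ -T ln ∑_{s} e^{-E/T}` since `∑_s e^{-E/T} ≤ ∑_s e^{-E} ≤ Z` and `Z ≥ 1`, `T ≤ 1`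
  have hfin : ∀ i ∈ s, energy v (Ψ i) ≠ ⊤ := fun i hi =>
    energy_ne_top_of_average_ne_top hA ((hmem i).1 hi)
  have horth : ∀ i ∈ s, ∀ j ∈ s, i ≠ j → ∫ X, conj ((Ψ i).ψ X) * (Ψ j).ψ X = 0 :=
    fun i _ j _ hij => hE.orthogonal hij
  have hle : ∑ i ∈ s, Real.exp (-((energy v (Ψ i)).toReal / T)) ≤ Z := by
    refine le_trans (Finset.sum_le_sum fun i _ => Real.exp_le_exp.2 ?_) (hZ m Ψ s horth hfin)
    rw [neg_le_neg_iff, le_div_iff₀ hT]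
    exact mul_le_of_le_one_right ENNReal.toReal_nonneg hT1
  have hpos : 0 < ∑ i ∈ s, Real.exp (-((energy v (Ψ i)).toReal / T)) := by
    have hsne : s.Nonempty := by
      by_contra h
      rw [Finset.not_nonempty_iff_eq_empty] at h
      have h1 := hE.sum_eq_one
      rw [← Finset.sum_filter_add_sum_filter_not Finset.univ (fun i => 0 < p i), ← hs, h,
        Finset.sum_empty, zero_add] at h1
      rw [Finset.sum_eq_zero (fun i hi => ?_)] at h1
      · exact zero_ne_one h1
      · rw [Finset.mem_filter] at hi
        exact le_antisymm (not_lt.1 hi.2) (hE.nonneg i)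
    exact Finset.sum_pos (fun i _ => Real.exp_pos _) hsne
  have hlogZ : 0 ≤ Real.log Z := Real.log_nonneg hZ1
  have hlog : Real.log (∑ i ∈ s, Real.exp (-((energy v (Ψ i)).toReal / T))) ≤ Real.log Z :=
    Real.log_le_log hpos hle
  nlinarith

/-! ### Low-temperature concentration -/


/-- **Entropy cannot buy much excitation energy at low temperature** (real form). For a finite
probability vector `p`, non-negative reals `eᵢ`, `0 < T ≤ 1/2` and `Z₁` with
`∑_{pᵢ>0} e^{-eᵢ} ≤ Z₁`: if `∑_{pᵢ>0} pᵢeᵢ - T S(p) ≤ η₁` then `∑_{pᵢ>0} pᵢeᵢ ≤ 2η₁ + 2T ln Z₁`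
(Gibbs' inequality at temperature `2T`). [folklore] -/
theorem sum_mul_le_of_sub_entropy_le {ι : Type*} [Fintype ι] [DecidableEq ι] {p : ι → ℝ}
    (hp0 : ∀ i, 0 ≤ p i) (hp1 : ∑ i, p i = 1) {e : ι → ℝ} (he : ∀ i, 0 < p i → 0 ≤ e i) {T : ℝ}
    (hT : 0 < T) (hT2 : T ≤ 1 / 2) {Z₁ : ℝ}
    (hZ : ∑ i ∈ Finset.univ.filter (fun i => 0 < p i), Real.exp (-e i) ≤ Z₁) {η₁ : ℝ}
    (hF : ∑ i ∈ Finset.univ.filter (fun i => 0 < p i), p i * e i - T * ∑ i, Real.negMulLog (p i) ≤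
      η₁) :
    ∑ i ∈ Finset.univ.filter (fun i => 0 < p i), p i * e i ≤ η₁ + η₁ + 2 * T * Real.log Z₁ := by
  set s := Finset.univ.filter (fun i => 0 < p i) with hs
  have h2T : 0 < 2 * T := by linarith
  have hG := neg_mul_log_sum_exp_le hp0 hp1 e h2T
  rw [← hs] at hG
  -- `∑_s e^{-e/(2T)} ≤ ∑_s e^{-e} ≤ Z₁`
  have hmem : ∀ i, i ∈ s ↔ 0 < p i := fun i => by simp [hs]
  have hle : ∑ i ∈ s, Real.exp (-(e i / (2 * T))) ≤ Z₁ := by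
    refine le_trans (Finset.sum_le_sum fun i hi => Real.exp_le_exp.2 ?_) hZ
    have hei : 0 ≤ e i := he i ((hmem i).1 hi)
    rw [neg_le_neg_iff, le_div_iff₀ h2T]
    calc e i * (2 * T) ≤ e i * 1 := by gcongr; linarith
      _ = e i := mul_one _
  have hsne : s.Nonempty := by
    by_contra h
    rw [Finset.not_nonempty_iff_eq_empty] at h
    have h1 := hp1
    rw [← Finset.sum_filter_add_sum_filter_not Finset.univ (fun i => 0 < p i), ← hs, h,
      Finset.sum_empty, zero_add] at h1
    rw [Finset.sum_eq_zero (fun i hi => ?_)] at h1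
    · exact zero_ne_one h1
    · rw [Finset.mem_filter] at hi
      exact le_antisymm (not_lt.1 hi.2) (hp0 i)
  have hpos : 0 < ∑ i ∈ s, Real.exp (-(e i / (2 * T))) :=
    Finset.sum_pos (fun i _ => Real.exp_pos _) hsne
  have hlog : Real.log (∑ i ∈ s, Real.exp (-(e i / (2 * T)))) ≤ Real.log Z₁ :=
    Real.log_le_log hpos hle
  have hG' : -(2 * T * Real.log Z₁) ≤ ∑ i ∈ s, p i * e i - 2 * T * ∑ i, Real.negMulLog (p i) := by
    refine le_trans ?_ hG
    nlinarith
  nlinarith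

/-- **Near-Gibbs ensembles have finite energy average** as soon as one trial state of finite
energy exists (compare with the pure state). [folklore] -/
theorem average_le_of_isNearGibbs {v : ℝ → ℝ≥0∞} {T ε : ℝ} {m : ℕ} {p : Fin m → ℝ}
    {Ψ : Fin m → TrialState N L} (hG : IsNearGibbs (energy v) TrialState.IsOrthogonal T ε p Ψ)
    (Φ : TrialState N L) :
    average (energy v) p Ψ ≤ energy v Φ + ENNReal.ofReal (T * entropy p + ε) := by
  have h := hG.le (isEnsemble_single TrialState.IsOrthogonal Φ)
  rw [entropy_single, mul_zero, ENNReal.ofReal_zero, add_zero, average_single] at h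
  exact h

/-- **Low-temperature concentration, mean form.** Let `Γ = (pᵢ, Ψᵢ)` be an `ε`-near-Gibbs finite
orthogonal ensemble of Dirichlet trial states at temperature `0 < T ≤ 1/2`, let `E₀ < ∞` be the
ground-state energy, `Ψ⋆` a trial state with `⟨Ψ⋆,HΨ⋆⟩ ≤ E₀ + η` (`η ≥ 0`), and `Z ≥ 1` a
partition bound (`∑_{s} e^{-E} ≤ Z` on orthonormal sub-families of finite energy). Then
`∑_{pᵢ>0} pᵢ (⟨Ψᵢ,HΨᵢ⟩ - E₀) ≤ 2(η + ε) + 2T (E₀ + ln Z)`. [folklore] -/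
theorem sum_mul_sub_groundStateEnergy_le {v : ℝ → ℝ≥0∞} (hE₀ : groundStateEnergy v N L ≠ ⊤)
    {Z : ℝ} (hZ1 : 1 ≤ Z)
    (hZ : ∀ (m : ℕ) (Ψ : Fin m → TrialState N L) (s : Finset (Fin m)),
      (∀ i ∈ s, ∀ j ∈ s, i ≠ j → ∫ X, conj ((Ψ i).ψ X) * (Ψ j).ψ X = 0) →
      (∀ i ∈ s, energy v (Ψ i) ≠ ⊤) →
        ∑ i ∈ s, Real.exp (-(energy v (Ψ i)).toReal) ≤ Z)
    {T : ℝ} (hT : 0 < T) (hT2 : T ≤ 1 / 2) {ε η : ℝ} (hε : 0 ≤ ε) (hη : 0 ≤ η)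
    {Φ : TrialState N L} (hΦ : energy v Φ ≤ groundStateEnergy v N L + ENNReal.ofReal η)
    {m : ℕ} {p : Fin m → ℝ} {Ψ : Fin m → TrialState N L}
    (hG : IsNearGibbs (energy v) TrialState.IsOrthogonal T ε p Ψ) :
    average (energy v) p Ψ ≠ ⊤ ∧
      ∑ i ∈ Finset.univ.filter (fun i => 0 < p i),
          p i * ((energy v (Ψ i)).toReal - (groundStateEnergy v N L).toReal) ≤
        2 * (η + ε) + 2 * T * ((groundStateEnergy v N L).toReal + Real.log Z) := by
  classical
  set s := Finset.univ.filter (fun i => 0 < p i) with hs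
  have hmem : ∀ i, i ∈ s ↔ 0 < p i := fun i => by simp [hs]
  set E₀ := groundStateEnergy v N L with hE₀def
  have hEns := hG.isEnsemble
  have hS0 : 0 ≤ entropy p := hEns.entropy_nonneg
  -- finiteness of the energy average
  have hAle := average_le_of_isNearGibbs hG Φ
  have hΦtop : energy v Φ ≠ ⊤ :=
    ne_top_of_le_ne_top (ENNReal.add_ne_top.2 ⟨hE₀, ENNReal.ofReal_ne_top⟩) hΦ
  have hAtop : average (energy v) p Ψ ≠ ⊤ :=
    ne_top_of_le_ne_top (ENNReal.add_ne_top.2 ⟨hΦtop, ENNReal.ofReal_ne_top⟩) hAle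
  refine ⟨hAtop, ?_⟩
  -- the comparison with the pure state, in reals
  have hA : (average (energy v) p Ψ).toReal ≤ E₀.toReal + η + (T * entropy p + ε) := by
    have h1 : average (energy v) p Ψ ≤ E₀ + ENNReal.ofReal η + ENNReal.ofReal (T * entropy p + ε) :=
      hAle.trans (add_le_add hΦ le_rfl)
    have h2 := ENNReal.toReal_mono (by
      exact ENNReal.add_ne_top.2 ⟨ENNReal.add_ne_top.2 ⟨hE₀, ENNReal.ofReal_ne_top⟩,
        ENNReal.ofReal_ne_top⟩) h1
    rwa [ENNReal.toReal_add (ENNReal.add_ne_top.2 ⟨hE₀, ENNReal.ofReal_ne_top⟩)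
      ENNReal.ofReal_ne_top, ENNReal.toReal_add hE₀ ENNReal.ofReal_ne_top,
      ENNReal.toReal_ofReal hη, ENNReal.toReal_ofReal (by positivity)] at h2
  rw [toReal_average_energy hEns.nonneg hAtop, ← hs] at hA
  -- excitation energies over the support
  have hsum_s : ∑ i ∈ s, p i = 1 := by
    rw [← hEns.sum_eq_one, ← Finset.sum_filter_add_sum_filter_not Finset.univ (fun i => 0 < p i)]
    rw [Finset.sum_eq_zero (s := Finset.univ.filter fun i => ¬0 < p i) (fun i hi => ?_), add_zero]
    rw [Finset.mem_filter] at hi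
    exact le_antisymm (not_lt.1 hi.2) (hEns.nonneg i)
  have hfin : ∀ i ∈ s, energy v (Ψ i) ≠ ⊤ := fun i hi =>
    energy_ne_top_of_average_ne_top hAtop ((hmem i).1 hi)
  have he0 : ∀ i, 0 < p i → 0 ≤ (energy v (Ψ i)).toReal - E₀.toReal := fun i hi =>
    sub_nonneg.2 (ENNReal.toReal_mono (hfin i ((hmem i).2 hi)) (groundStateEnergy_le_energy v (Ψ i)))
  -- the free-energy excess over the support is `≤ η + ε`
  have hF : ∑ i ∈ s, p i * ((energy v (Ψ i)).toReal - E₀.toReal) - T * ∑ i, Real.negMulLog (p i) ≤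
      η + ε := by
    have h1 : ∑ i ∈ s, p i * ((energy v (Ψ i)).toReal - E₀.toReal) =
        ∑ i ∈ s, p i * (energy v (Ψ i)).toReal - E₀.toReal := by
      simp only [mul_sub, Finset.sum_sub_distrib, ← Finset.sum_mul, hsum_s, one_mul]
    rw [h1]
    unfold entropy at hA
    linarith
  -- the shifted partition bound `∑_s e^{-(E - E₀)} ≤ e^{E₀} Z`
  have hZ₁ : ∑ i ∈ s, Real.exp (-((energy v (Ψ i)).toReal - E₀.toReal)) ≤
      Real.exp E₀.toReal * Z := by
    have h1 : ∀ i, Real.exp (-((energy v (Ψ i)).toReal - E₀.toReal)) =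
        Real.exp E₀.toReal * Real.exp (-(energy v (Ψ i)).toReal) := fun i => by
      rw [← Real.exp_add]; congr 1; ring
    simp only [h1, ← Finset.mul_sum]
    exact mul_le_mul_of_nonneg_left
      (hZ m Ψ s (fun i _ j _ hij => hEns.orthogonal hij) hfin) (Real.exp_nonneg _)
  have hmain := sum_mul_le_of_sub_entropy_le hEns.nonneg hEns.sum_eq_one he0 hT hT2 hZ₁ hF
  rw [Real.log_mul (Real.exp_pos _).ne' (by linarith), Real.log_exp] at hmain
  linarith

/-- **Low-temperature concentration, Markov form.** In the situation of
`sum_mul_sub_groundStateEnergy_le`, for every `δ > 0` the total weight of the states of energy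
`> E₀ + δ` is at most `(2(η + ε) + 2T(E₀ + ln Z))/δ`. [folklore] -/
theorem mul_sum_weights_high_le {v : ℝ → ℝ≥0∞} (hE₀ : groundStateEnergy v N L ≠ ⊤)
    {Z : ℝ} (hZ1 : 1 ≤ Z)
    (hZ : ∀ (m : ℕ) (Ψ : Fin m → TrialState N L) (s : Finset (Fin m)),
      (∀ i ∈ s, ∀ j ∈ s, i ≠ j → ∫ X, conj ((Ψ i).ψ X) * (Ψ j).ψ X = 0) →
      (∀ i ∈ s, energy v (Ψ i) ≠ ⊤) →
        ∑ i ∈ s, Real.exp (-(energy v (Ψ i)).toReal) ≤ Z)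
    {T : ℝ} (hT : 0 < T) (hT2 : T ≤ 1 / 2) {ε η : ℝ} (hε : 0 ≤ ε) (hη : 0 ≤ η)
    {Φ : TrialState N L} (hΦ : energy v Φ ≤ groundStateEnergy v N L + ENNReal.ofReal η)
    {m : ℕ} {p : Fin m → ℝ} {Ψ : Fin m → TrialState N L}
    (hG : IsNearGibbs (energy v) TrialState.IsOrthogonal T ε p Ψ) {δ : ℝ} (hδ : 0 < δ) :
    δ * ∑ i ∈ Finset.univ.filter
        (fun i => 0 < p i ∧ groundStateEnergy v N L + ENNReal.ofReal δ < energy v (Ψ i)), p i ≤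
      2 * (η + ε) + 2 * T * ((groundStateEnergy v N L).toReal + Real.log Z) := by
  classical
  obtain ⟨hAtop, hmean⟩ := sum_mul_sub_groundStateEnergy_le hE₀ hZ1 hZ hT hT2 hε hη hΦ hG
  refine le_trans ?_ hmean
  set E₀ := groundStateEnergy v N L with hE₀def
  have hEns := hG.isEnsemble
  rw [Finset.mul_sum]
  calc ∑ i ∈ Finset.univ.filter (fun i => 0 < p i ∧ E₀ + ENNReal.ofReal δ < energy v (Ψ i)),
        δ * p i ≤ ∑ i ∈ Finset.univ.filter (fun i => 0 < p i ∧ E₀ + ENNReal.ofReal δ < energy v (Ψ i)),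
        p i * ((energy v (Ψ i)).toReal - E₀.toReal) := by
        refine Finset.sum_le_sum fun i hi => ?_
        rw [Finset.mem_filter] at hi
        have hfin : energy v (Ψ i) ≠ ⊤ := energy_ne_top_of_average_ne_top hAtop hi.2.1
        have hlt : E₀.toReal + δ < (energy v (Ψ i)).toReal := by
          have h := (ENNReal.toReal_lt_toReal (ENNReal.add_ne_top.2 ⟨hE₀, ENNReal.ofReal_ne_top⟩)
            hfin).2 hi.2.2
          rwa [ENNReal.toReal_add hE₀ ENNReal.ofReal_ne_top, ENNReal.toReal_ofReal hδ.le] at h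
        rw [mul_comm]
        exact mul_le_mul_of_nonneg_left (by linarith) (hEns.nonneg i)
    _ ≤ ∑ i ∈ Finset.univ.filter (fun i => 0 < p i),
        p i * ((energy v (Ψ i)).toReal - E₀.toReal) := by
        refine Finset.sum_le_sum_of_subset_of_nonneg (fun i hi => ?_) (fun i hi _ => ?_)
        · rw [Finset.mem_filter] at hi ⊢
          exact ⟨hi.1, hi.2.1⟩
        · rw [Finset.mem_filter] at hi
          have hfin : energy v (Ψ i) ≠ ⊤ := energy_ne_top_of_average_ne_top hAtop hi.2
          exact mul_nonneg (hEns.nonneg i)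
            (sub_nonneg.2 (ENNReal.toReal_mono hfin (groundStateEnergy_le_energy v (Ψ i))))

end ThermalGroundStateLimit

end Summit.AtomisticToContinuum.BoseEinsteinCondensation.Theorems

end
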